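import Literature.NumberTheory.Automorphic.RamakrishnanTheoremMProofs
import Literature.NumberTheory.Automorphic.RamakrishnanTensorProductGL2Proofs
import Literature.NumberTheory.Automorphic.ClassFieldCharacterFrobenius
import Literature.NumberTheory.Automorphic.QuadraticCharacterTwist
import Literature.NumberTheory.GaloisRepresentations.HeckeCharacterGaloisAvatarProofs
import Literature.NumberTheory.GaloisRepresentations.GlobalArtinMapAbstractExtensionProofs
import Literature.NumberTheory.GaloisRepresentations.GlobalReciprocityCyclicDescentProofs
import HarnessLib

/-!
# Quadratic self-twists of `GL(2)` representations come from quadratic fields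
# (the two renderings of "dihedral" agree), and Theorem M implies its cuspidal-case vendoring

Topic `NumberTheory/Automorphic`; namespace `Literature.NumberTheory.Automorphic`. Proof file
(theorems only: no new notion, no named fact, no `sorry`), third sibling of
`RamakrishnanTensorProductGL2` after `RamakrishnanTheoremMProofs` and
`RamakrishnanTheoremMOnlyIfProofs`, for the named fact `Ramakrishnan2000_theoremM` — D. Ramakrishnan,
*Modularity of the Rankin–Selberg `L`-series, and multiplicity one for `SL(2)`*, Ann. of Math. (2)
**152** (2000), 45–111 [Ramakrishnan2000], Theorem M (§3).

## What is proved

The tree renders Ramakrishnan's hypothesis "`π` is (not) associated to a character of a quadratic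
extension" (`π` dihedral, `π = I_K^F(μ)`; op. cit. Prop. 2.3.1 (2): "The image of `I_{K/F}` consists
precisely of those `π ∈ 𝒜(nℓ, F)` such that `π ≃ π ⊗ χ`", `χ = χ_{K/F}`) in two ways:

* `IsSatakeSelfTwist π` (`RamakrishnanTensorProductGL2`): some Hecke character `δ ≠ 1` twists `π` to
  itself at the level of Satake parameters almost everywhere — the rendering of
  `Ramakrishnan2000_theoremM`;
* `∃ K/F` quadratic with `IsQuadraticSelfTwistAE K π` (`LanglandsTetrahedral`): the Satake
  parameters of `π` are stable under the sign `ε_{K/F}(v)` of a quadratic field `K` almost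
  everywhere — the rendering of `Ramakrishnan2000_boxTimes_cuspidal` (`RamakrishnanBoxTimes`) and of
  the Gelbart–Jacquet facts (`GelbartJacquet_symmSq_cuspidal`, `GelbartJacquet_adjoint_lift`).

`RamakrishnanTheoremMProofs` proved the second implies the first. This file proves the converse,
whose content is **global CFT for quadratic characters** — every idele-group character of order
two is the character `η_{K/F}` "vanishing exactly on `F^× N(𝔸_K^×)`" of a quadratic extension
`K/F` — now available in the tree as theorems (`HeckeCharacter.exists_eq_charHecke_of_isFiniteOrder`:
Tate's Main Theorem (B), (D) of Cassels–Fröhlich Ch. VII in character form, with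
`artinReciprocity_character_holds`):

* `HeckeCharacter.exists_quadratic_isClassFieldCharacter` — **a Hecke character `δ` with `δ² = 1`,
  `δ ≠ 1` is the CFT character of a quadratic extension**: there is a quadratic `K/F` with
  `δ(x) = 1 ↔ x ∈ F^× N(𝔸_K^×)` (`IsClassFieldCharacter`). Proof: `δ = χ ∘ ψ_{L/F}` for a character
  `χ` of the group of a finite abelian `L ⊆ F̄` (loc. cit.); `ψ_{L/F}` being onto
  (`artinIdeleMap_surjective`), `χ² = 1 ≠ χ`, so `H = ker χ` has index `2` and `K = L^H` is
  quadratic; at a place `v` unramified in `L`, `δ(ϖ_v) = χ(Frob_v)` (`charHecke_valueAtUniformizer`)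
  and `Frob_v^{f_v(K)} ∈ Gal(L/K) = H` (`restrictNormalHom_pow_inertiaDeg_eq_one`: the Frobenius of
  `K/F` below has order `f_v(K)`), whence `(δ ∘ N_{K/F})(ϖ_w) = δ(ϖ_v)^{f_v(K)} = 1` at almost every
  place `w` of `K` (`compRelNorm_valueAtUniformizer`), `δ ∘ N_{K/F} = 1` (rigidity of Hecke
  characters, `eq_one_of_eventually_valueAtUniformizer_eq_one`), i.e. `δ` kills `F^× N(𝔸_K^×)` — a
  subgroup of index `[K : F] = 2` (`index_normGroup_eq_finrank_abstract`, Tate's (B) for `K/F`) — and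
  `δ ≠ 1` forces `ker δ = F^× N(𝔸_K^×)`.
* `IsSatakeSelfTwist.exists_isQuadraticSelfTwistAE`, `isSatakeSelfTwist_iff_exists_isQuadraticSelfTwistAE`
  — **the two renderings of "dihedral" agree** for automorphic `π` on `GL(2)/F`: a self-twisting
  `δ ≠ 1` is quadratic (`δ² = 1` comparing `e₂` of the Satake parameters,
  `IsSatakeTwistBy.pow_eq_one_of_self`), hence `δ = η_{K/F}` for a quadratic `K` (above), and
  `η_{K/F}(ϖ_v) = ε_{K/F}(v)` almost everywhere (`IsClassFieldCharacter.eventually_isPrimitiveRoot_valueAtUniformizer`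
  with `valueAtUniformizer_eq_quadraticSign_of_orderOf`: Arthur–Clozel's "`ζ_v = η(ϖ_v)` is a root of
  unity of order `f_v`"); Satake parameters being unique (Flath), `t_{π,v}` is then `ε_{K/F}(v)`-stable.
  Corollary `not_isSatakeSelfTwist_iff_forall_not_isQuadraticSelfTwistAE`: the hypothesis
  "`∀ K/F` quadratic, `¬ IsQuadraticSelfTwistAE K π`" of `Ramakrishnan2000_boxTimes_cuspidal` and of the
  Gelbart–Jacquet facts **is** `¬ IsSatakeSelfTwist π`.
* `Ramakrishnan2000_boxTimes_cuspidal_of_theoremM` — **`Ramakrishnan2000_theoremM` implies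
  `Ramakrishnan2000_boxTimes_cuspidal`** (the cuspidal-case vendoring consumed by
  `Summits/Langlands`, crux `TrigonalHeart`): with the renderings identified, the "if" half of the
  cuspidality criterion of Theorem M is exactly the conclusion of the cuspidal-case fact. Together
  with `Ramakrishnan2000_theoremM.of_boxTimes_cuspidal_of_special_types`
  (`RamakrishnanTheoremMOnlyIfProofs`) the two vendorings of Theorem M are now comparable inside the
  tree: `theoremM ⟹ boxTimes_cuspidal`, and `boxTimes_cuspidal ∧` Lemma 3.1.1 (II), (III) `∧` three
  Jacquet–Shalika / Borel–Jacquet leaves `⟹ theoremM`.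

Nothing here assumes `Ramakrishnan2000_theoremM` except the last theorem, which takes it as a
hypothesis; no statement of the tree is modified.

## References

* [Ramakrishnan2000] D. Ramakrishnan, op. cit., Theorem M (§3, preprint p. 9) and Prop. 2.3.1 (2)
  (preprint p. 8: the image of automorphic induction from a quadratic extension).
* [CasselsFrohlichANT1967] J. Tate, *Global class field theory*, Ch. VII of Cassels–Fröhlich,
  *Algebraic Number Theory* (1967): §5.1 Main Theorem (A), (B), (D); §4.2 Corollary (iii)
  (`ω_χ(ϖ_v) = χ(Frob_v)`); §2.3 (decomposition law in prime degree).
* [ArthurClozelAMS120] J. Arthur, L. Clozel, *Simple algebras, base change, and the advanced theory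
  of the trace formula*, Ann. of Math. Stud. 120 (1989), Ch. 3 §4 (the character `η` "vanishing
  exactly on `F^* N(𝔸_E^*)`") and proof of Thm. 3.1, p. 172 ("`ζ_v = η(ϖ_v)` … a root of unity of
  order `f_v`").
* [NeukirchANT1999] J. Neukirch, *Algebraic Number Theory*, Ch. I §9 (9.4)–(9.5) (Frobenius in
  towers).
-/

noncomputable section

open scoped NumberField Classical
open NumberField IsDedekindDomain Filter

namespace Literature.NumberTheory.Automorphic

open Literature.NumberTheory.GaloisRepresentations

variable {F : Type} [Field F] [NumberField F]

/-! ### CFT: a quadratic idele-group character is the character of a quadratic extension -/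

section CFT

/-- `-1 ≠ 1` in `ℂˣ`. [folklore] -/
private theorem neg_one_ne_one_units : (-1 : ℂˣ) ≠ 1 := by
  intro h
  have h' := congrArg Units.val h
  norm_num at h'

/-- In `ℂˣ`, `u² = 1` forces `u = 1` or `u = -1`. [folklore] -/
private theorem eq_one_or_eq_neg_one_of_sq_eq_one {u : ℂˣ} (hu : u ^ 2 = 1) : u = 1 ∨ u = -1 := by
  have h : ((u : ℂ)) * (u : ℂ) = 1 := by
    rw [← pow_two, ← Units.val_pow_eq_pow_val, hu, Units.val_one]
  rcases mul_self_eq_one_iff.mp h with h' | h'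
  · exact Or.inl (Units.val_eq_one.mp h')
  · refine Or.inr (Units.val_inj.mp ?_)
    rw [h', Units.val_neg, Units.val_one]

/-- **A Hecke character of order two is the CFT character of a quadratic extension**
(Tate, Cassels–Fröhlich Ch. VII §5.1 Main Theorem (B), (D), for characters of order `2`; in
Arthur–Clozel's words, Ch. 3 §4: `η` "vanishing exactly on `F^* N(𝔸_E^*)`"). For a Hecke character
`δ` of the number field `F` with `δ² = 1` and `δ ≠ 1` there is a quadratic extension `K/F` such that
`δ(x) = 1 ↔ x ∈ F^× N(𝔸_K^×)` for every idele `x` of `F` (`HeckeCharacter.IsClassFieldCharacter`).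
Proof (tree CFT, all theorems): `δ = χ ∘ ψ_{L/F}` for a finite abelian `L ⊆ F̄` and a character `χ`
of `Gal(L/F)` (`HeckeCharacter.exists_eq_charHecke_of_isFiniteOrder`); as `ψ_{L/F}` is onto,
`χ² = 1 ≠ χ`, `H = ker χ` has index `2` and `K = L^H` is quadratic over `F`; for `v` unramified in `L`,
`δ(ϖ_v) = χ(Frob_v)` and `Frob_v^{f_v(K)}` restricts trivially to `K`, i.e. lies in `H`, so
`δ ∘ N_{K/F}` is `1` at almost every uniformizer of `K`, hence trivial; thus `δ` kills
`F^× N(𝔸_K^×)`, of index `[K : F] = 2`, and `δ ≠ 1` gives equality of kernels.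
[cite: CasselsFrohlichANT1967, Ch. VII §5.1 Main Theorem (B), (D) and §4.2 Corollary (iii)]
[cite: ArthurClozelAMS120, Ch. 3 §4 (before Thm. 4.2)] -/
theorem _root_.Literature.NumberTheory.GaloisRepresentations.HeckeCharacter.exists_quadratic_isClassFieldCharacter
    (δ : HeckeCharacter F) (hδ2 : δ ^ 2 = 1) (hδ1 : δ ≠ 1) :
    ∃ (K : Type) (_ : Field K) (_ : NumberField K) (_ : Algebra F K),
      Module.finrank F K = 2 ∧ δ.IsClassFieldCharacter K := by
  classical
  have hfo : δ.IsFiniteOrder := isOfFinOrder_iff_pow_eq_one.mpr ⟨2, two_pos, hδ2⟩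
  obtain ⟨L, hLfd, hLab, χ, hδχ⟩ := δ.exists_eq_charHecke_of_isFiniteOrder hfo
  haveI : NumberField L := NumberField.of_module_finite F L
  -- (1) `χ² = 1`, `χ ≠ 1`: values `±1`, and an element `g₀` with `χ g₀ = -1`
  have hχsq : ∀ g : L ≃ₐ[F] L, χ g ^ 2 = 1 := fun g => by
    obtain ⟨x, rfl⟩ := artinIdeleMap_surjective L artinReciprocity_character_holds g
    rw [apply_artinIdeleMap, ← hδχ, ← HeckeCharacter.pow_apply, hδ2, HeckeCharacter.one_apply]
  have hχ1 : χ ≠ 1 := by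
    rintro rfl
    exact hδ1 (hδχ.trans (charHecke_one L artinReciprocity_character_holds))
  obtain ⟨g₀, hg₀⟩ : ∃ g₀ : L ≃ₐ[F] L, χ g₀ ≠ 1 := by
    by_contra h
    push Not at h
    exact hχ1 (MonoidHom.ext h)
  have hval : ∀ g : L ≃ₐ[F] L, χ g = 1 ∨ χ g = -1 := fun g =>
    eq_one_or_eq_neg_one_of_sq_eq_one (hχsq g)
  have hg₀' : χ g₀ = -1 := (hval g₀).resolve_left hg₀
  -- (2) the quadratic field `K = L^{ker χ}`
  set H : Subgroup (L ≃ₐ[F] L) := χ.ker with hHdef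
  have hHidx : H.index = 2 := by
    refine Subgroup.index_eq_two_iff.mpr ⟨g₀, fun b => ?_⟩
    change Xor (b * g₀ ∈ χ.ker) (b ∈ χ.ker)
    rw [MonoidHom.mem_ker, MonoidHom.mem_ker, map_mul, hg₀']
    rcases hval b with hb | hb
    · rw [hb, one_mul]
      exact Or.inr ⟨rfl, neg_one_ne_one_units⟩
    · rw [hb, neg_mul_neg, one_mul]
      exact Or.inl ⟨rfl, neg_one_ne_one_units⟩
  set K : IntermediateField F L := IntermediateField.fixedField H with hKdef
  haveI : NumberField K := NumberField.of_module_finite F K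
  have hK2 : Module.finrank F K = 2 := by
    have h1 : Module.finrank K L = Nat.card H := IntermediateField.finrank_fixedField_eq_card H
    have h2 := Module.finrank_mul_finrank F K L
    have h3 : Nat.card (L ≃ₐ[F] L) = Module.finrank F L := IsGalois.card_aut_eq_finrank F L
    have h4 : Nat.card H * H.index = Nat.card (L ≃ₐ[F] L) := Subgroup.card_mul_index H
    have hH0 : Nat.card H ≠ 0 := Nat.card_pos.ne'
    rw [h1, ← h3, ← h4, hHidx] at h2
    exact mul_right_cancel₀ hH0 (h2.trans (mul_comm _ _))
  -- (3) `Frob_v^{f_v(K)} ∈ H` at the places unramified in `K`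
  have hkey : ∀ v : HeightOneSpectrum (𝓞 F), Algebra.IsUnramifiedIn (𝓞 K) v.asIdeal →
      galFrob F L v ^ v.asIdeal.inertiaDegIn (𝓞 K) ∈ H := by
    intro v hvK
    obtain ⟨Q, hQ, hφ⟩ := galFrob_spec F L v
    haveI := hQ.1
    haveI := hQ.2
    haveI : v.asIdeal.IsMaximal := v.isMaximal
    haveI : IsGaloisGroup (K ≃ₐ[F] K) (𝓞 F) (𝓞 K) := IsGaloisGroup.of_isFractionRing _ _ _ F K
    have hf : v.asIdeal.inertiaDegIn (𝓞 K) = (Q.under (𝓞 K)).inertiaDeg (𝓞 F) :=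
      Ideal.inertiaDegIn_eq_inertiaDeg v.asIdeal (Q.under (𝓞 K)) (K ≃ₐ[F] K)
    have hmem : galFrob F L v ^ (Q.under (𝓞 K)).inertiaDeg (𝓞 F) ∈
        (AlgEquiv.restrictNormalHom (F := F) (K₁ := L) K).ker :=
      restrictNormalHom_pow_inertiaDeg_eq_one (K := F) (E := K) (M' := L) hvK hQ hφ
    rw [IntermediateField.restrictNormalHom_ker, hKdef, IntermediateField.fixingSubgroup_fixedField]
      at hmem
    rw [hf]
    exact hmem
  -- (4) `δ ∘ N_{K/F} = 1`
  have hunrL : ∀ᶠ v : HeightOneSpectrum (𝓞 F) in cofinite, Algebra.IsUnramifiedIn (𝓞 L) v.asIdeal :=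
    eventually_isUnramifiedIn L
  have hunrK : ∀ᶠ v : HeightOneSpectrum (𝓞 F) in cofinite,
      Algebra.IsUnramifiedIn (𝓞 K) v.asIdeal := by
    rw [eventually_cofinite]
    exact finite_setOf_not_isUnramifiedIn F K
  have hcomp : HeckeCharacter.compRelNorm K δ = 1 := by
    refine HeckeCharacter.eq_one_of_eventually_valueAtUniformizer_eq_one ?_
    have hT := (HeightOneSpectrum.tendsto_under_cofinite (𝓞 F) (B := 𝓞 K)).eventually
      (hunrL.and hunrK)
    filter_upwards [hT] with w hw
    obtain ⟨hvL, hvK⟩ := hw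
    have hδunr : δ.IsUnramifiedAt (w.under (𝓞 F)) := by
      rw [hδχ]
      exact charHecke_isUnramifiedAt L χ artinReciprocity_character_holds hvL
    rw [δ.compRelNorm_valueAtUniformizer (E := K) rfl hvK hδunr,
      ramificationIdxIn_eq_one_of_isUnramifiedIn hvK, one_mul]
    have hδv : ((δ (localUnits (w.under (𝓞 F))
        (HeckeCharacter.uniformizer F (w.under (𝓞 F)))) : ℂˣ) : ℂ) =
        ((χ (galFrob F L (w.under (𝓞 F))) : ℂˣ) : ℂ) := by
      rw [← charHecke_valueAtUniformizer L χ artinReciprocity_character_holds hvL, hδχ]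
      rfl
    rw [hδv, ← Units.val_pow_eq_pow_val, ← map_pow, (MonoidHom.mem_ker).mp (hkey _ hvK),
      Units.val_one]
  -- (5) `δ` kills the norm group, of index `2`, and `δ ≠ 1`
  have htriv : δ.IsTrivialOnNormGroup K :=
    (δ.isTrivialOnNormGroup_iff_forall_ideleRelNorm K).mpr fun y => by
      have h := congrArg (fun ω : HeckeCharacter K => ω y) hcomp
      simpa only [HeckeCharacter.compRelNorm_apply, HeckeCharacter.one_apply] using h
  have hidx : (normGroup F K).index = 2 := by
    rw [index_normGroup_eq_finrank_abstract F K artinReciprocity_character_holds, hK2]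
  refine ⟨K, inferInstance, inferInstance, inferInstance, hK2, fun x => ⟨fun hx => ?_, htriv x⟩⟩
  by_contra hxN
  refine hδ1 (HeckeCharacter.ext fun y => ?_)
  rw [HeckeCharacter.one_apply]
  by_cases hy : y ∈ normGroup F K
  · exact htriv y hy
  · have hmem : x⁻¹ * y ∈ normGroup F K := by
      rw [Subgroup.mul_mem_iff_of_index_two hidx]
      exact iff_of_false (fun h => hxN ((Subgroup.inv_mem_iff _).mp h)) hy
    have h := htriv _ hmem
    rwa [map_mul, map_inv, hx, inv_one, one_mul] at h

end CFT

/-! ### The two renderings of "dihedral" agree -/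

section Dihedral

variable {hF : isCompact_glFiniteIntegralLevel 2 F}

/-- **A self-twisting automorphic representation of `GL(2)/F` is a self-twist by the sign of a
quadratic field** (Ramakrishnan 2000, Prop. 2.3.1 (2) and the proof of Theorem M: "associated to a
character of a quadratic extension `K`", with Labesse–Langlands; here only the character-theoretic
half is needed and proved). If `t_{π,v} = δ(ϖ_v) t_{π,v}` for almost all `v` with `δ ≠ 1`
(`IsSatakeSelfTwist π`), then `δ² = 1` (comparing `e₂`), `δ` is the CFT character of a quadratic
`K/F` (`HeckeCharacter.exists_quadratic_isClassFieldCharacter`), `δ(ϖ_v) = ε_{K/F}(v)` for almost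
all `v` (a root of unity of order `f_v`), and by the uniqueness of Satake parameters (Flath)
`ε_{K/F}(v) t_{π,v} = t_{π,v}` almost everywhere: `IsQuadraticSelfTwistAE K π`.
[cite: Ramakrishnan2000, Prop. 2.3.1 (2)] [cite: ArthurClozelAMS120, Ch. 3, proof of Thm. 3.1 (p. 172)] -/
theorem IsSatakeSelfTwist.exists_isQuadraticSelfTwistAE
    {π : AutomorphicRepData (AutomorphyDatum.gl 2 F hF)} (h : IsSatakeSelfTwist π) :
    ∃ (K : Type) (_ : Field K) (_ : NumberField K) (_ : Algebra F K),
      Module.finrank F K = 2 ∧ IsQuadraticSelfTwistAE K π := by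
  obtain ⟨δ, hδ1, hδ2, hδ⟩ := h.exists_pow_eq_one
  obtain ⟨K, _, _, _, hK2, hδK⟩ := δ.exists_quadratic_isClassFieldCharacter hδ2 hδ1
  refine ⟨K, inferInstance, inferInstance, inferInstance, hK2, ?_⟩
  haveI : FiniteDimensional F K := Module.finite_of_finrank_eq_succ hK2
  haveI : Algebra.IsQuadraticExtension F K := ⟨hK2⟩
  have hprime : (Module.finrank F K).Prime := by rw [hK2]; exact Nat.prime_two
  have hunrK : ∀ᶠ v : HeightOneSpectrum (𝓞 F) in cofinite,
      Algebra.IsUnramifiedIn (𝓞 K) v.asIdeal := by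
    rw [eventually_cofinite]
    exact finite_setOf_not_isUnramifiedIn F K
  filter_upwards [hδ, hδK.eventually_isPrimitiveRoot_valueAtUniformizer hprime, hunrK] with v hv
    hroot hvK α hα
  rw [← valueAtUniformizer_eq_quadraticSign_of_orderOf hK2 δ hvK hroot.eq_orderOf.symm]
  exact π.hasSatakeParamAt_unique_holds (hv α hα) hα

-- buildfix (Literature FQN clash #3 = DUP-FQN set 039): `RamakrishnanBoxTimesProofs.lean` owns the constant
-- `Literature.NumberTheory.Automorphic.isSatakeSelfTwist_iff_exists_isQuadraticSelfTwistAE` (its version carries an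
-- explicit class-field-theory hypothesis `hCFT`), so that module and this one could not be co-imported (`Literature`
-- root aggregate).  The unconditional version below (statement text unchanged) therefore lives in the sub-namespace
-- `ClassField` and is re-exported under its old name as an alias for importers of this module alone.
namespace ClassField

/-- **The two renderings of "`π` is dihedral" agree**: an automorphic `π` on `GL(2)/F` admits a
non-trivial self-twist by a Hecke character at the level of Satake parameters a.e.
(`IsSatakeSelfTwist`, the rendering of `Ramakrishnan2000_theoremM`) iff for some quadratic `K/F` its
Satake parameters are `ε_{K/F}(v)`-stable a.e. (`IsQuadraticSelfTwistAE`, the rendering of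
`Ramakrishnan2000_boxTimes_cuspidal` and of the Gelbart–Jacquet facts). The "if" is
`isSatakeSelfTwist_of_isQuadraticSelfTwistAE` (`RamakrishnanTheoremMProofs`).
[cite: Ramakrishnan2000, Prop. 2.3.1 (2)] -/
theorem isSatakeSelfTwist_iff_exists_isQuadraticSelfTwistAE
    {π : AutomorphicRepData (AutomorphyDatum.gl 2 F hF)} :
    IsSatakeSelfTwist π ↔ ∃ (K : Type) (_ : Field K) (_ : NumberField K) (_ : Algebra F K),
      Module.finrank F K = 2 ∧ IsQuadraticSelfTwistAE K π :=
  ⟨fun h => h.exists_isQuadraticSelfTwistAE,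
    fun ⟨K, _, _, _, hK2, h⟩ => isSatakeSelfTwist_of_isQuadraticSelfTwistAE K hK2 h⟩

end ClassField

export ClassField (isSatakeSelfTwist_iff_exists_isQuadraticSelfTwistAE)

/-- **"Not dihedral" in the two renderings**: `π` admits no non-trivial self-twist iff for no
quadratic `K/F` are its Satake parameters `ε_{K/F}`-stable a.e. — the hypothesis shape of
`Ramakrishnan2000_boxTimes_cuspidal`, `GelbartJacquet_symmSq_cuspidal`, `GelbartJacquet_adjoint_lift`.
[cite: Ramakrishnan2000, Prop. 2.3.1 (2)] -/
theorem not_isSatakeSelfTwist_iff_forall_not_isQuadraticSelfTwistAE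
    {π : AutomorphicRepData (AutomorphyDatum.gl 2 F hF)} :
    ¬ IsSatakeSelfTwist π ↔ ∀ (K : Type) [Field K] [NumberField K] [Algebra F K],
      Module.finrank F K = 2 → ¬ IsQuadraticSelfTwistAE K π := by
  constructor
  · intro h K _ _ _ hK2
    exact not_isQuadraticSelfTwistAE_of_not_isSatakeSelfTwist h K hK2
  · rintro h hπ
    obtain ⟨K, _, _, _, hK2, hq⟩ := hπ.exists_isQuadraticSelfTwistAE
    exact h K hK2 hq

end Dihedral

/-! ### Theorem M implies its cuspidal-case vendoring -/

section BoxTimes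

/-- **`Ramakrishnan2000_theoremM` implies `Ramakrishnan2000_boxTimes_cuspidal`.** Both vendor
Theorem M of op. cit. (the second: Existence and the "if" half of the cuspidality criterion for
pairs without quadratic self-twists); their hypotheses differ only in the rendering of "dihedral"
(`IsSatakeSelfTwist` versus `IsQuadraticSelfTwistAE` for all quadratic `K/F`, identified by
`not_isSatakeSelfTwist_iff_forall_not_isQuadraticSelfTwistAE`) and of condition (C)
(`IsSatakeTwistBy` versus its pointwise form, identified by `isSatakeTwistBy_iff_eventually_eq_map`
of `RamakrishnanTheoremMProofs`). [cite: Ramakrishnan2000, Theorem M (§3) with Prop. 3.2.1] -/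
theorem Ramakrishnan2000_boxTimes_cuspidal_of_theoremM (h : Ramakrishnan2000_theoremM) :
    Ramakrishnan2000_boxTimes_cuspidal := by
  intro F _ _ h2 h4 π π' hdih hC
  have hπ : ¬ IsSatakeSelfTwist π.1 :=
    not_isSatakeSelfTwist_iff_forall_not_isQuadraticSelfTwistAE.mpr fun K _ _ _ hK =>
      (hdih K hK).1
  have hπ' : ¬ IsSatakeSelfTwist π'.1 :=
    not_isSatakeSelfTwist_iff_forall_not_isQuadraticSelfTwistAE.mpr fun K _ _ _ hK =>
      (hdih K hK).2
  have hC' : ¬ ∃ χ : HeckeCharacter F, IsSatakeTwistBy π.1 π'.1 χ := fun ⟨χ, hχ⟩ =>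
    hC χ ((isSatakeTwistBy_iff_eventually_eq_map π.1 π'.1 χ).1 hχ)
  exact h.exists_cuspidal h2 h4 π π' hπ hπ' hC'

end BoxTimes

end Literature.NumberTheory.Automorphic

end
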